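import Literature.NumberTheory.GaloisRepresentations.IntegralGaloisAction
import Mathlib.Analysis.Normed.Unbundled.SpectralNorm
import Mathlib.RingTheory.Valuation.LocalSubring
import Mathlib.RingTheory.DedekindDomain.AdicValuation
import Mathlib.NumberTheory.NumberField.Completion.FinitePlace
import HarnessLib

/-!
# The valuation on the algebraic closure of a complete field: integers, the prime, inertia

Let `L` be a field complete with respect to a nontrivial ultrametric absolute value `‖·‖`, with
valuation ring `R = {x : ‖x‖ ≤ 1}`, and let `Ω = L̄ = AlgebraicClosure L`. By Neukirch,
*Algebraic Number Theory*, Ch. II (4.8), `‖·‖` extends uniquely to `Ω`; Mathlib realises the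
extension as the spectral norm `spectralNorm L Ω`
(`Mathlib/Analysis/Normed/Unbundled/SpectralNorm`, after Bosch–Güntzer–Remmert 3.2), a
multiplicative ultrametric `L`-algebra norm (`spectralNorm.normedField`). This file records, for
the tree's ring of absolute integers `Literature.absIntegers R L = integralClosure R Ω` with its action
of `Γ_L = Field.absoluteGaloisGroup L` (file `IntegralGaloisAction`), the three standard
consequences used to compare local and global inertia groups (Silverman, *AEC*, X.§4; Neukirch,
Ch. II §9):

* `Literature.NumberTheory.GaloisRepresentations.mem_absIntegers_iff_spectralNorm_le_one`: `integralClosure R Ω = {b : ‖b‖ ≤ 1}` — the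
  valuation ring of the extended absolute value is the integral closure of `R`
  (Neukirch II (4.8), formula `(*)` of its proof, via (4.7) = `spectralValue_le_one_iff`);
* `Literature.NumberTheory.GaloisRepresentations.mem_iff_spectralNorm_lt_one`: every prime `𝔐` of `integralClosure R Ω` above the
  maximal ideal of `R` is the open unit ball `{b : ‖b‖ < 1}`; in particular it is unique
  (`Literature.NumberTheory.GaloisRepresentations.eq_of_liesOver_maximalIdeal`) — the maximal ideal of the valuation ring of Neukirch II
  (4.8) with (3.8);
* `Literature.NumberTheory.GaloisRepresentations.spectralNorm_absoluteGaloisGroup_smul`: `Γ_L` acts on `Ω` by isometries (uniqueness in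
  Neukirch II (4.8); Mathlib `spectralNorm_eq_of_equiv`), and consequently
  `Literature.NumberTheory.GaloisRepresentations.mem_inertia_iff_spectralNorm`: `σ ∈ Γ_L` lies in the inertia group `I_𝔐` (Mathlib's
  `Ideal.inertia`: `σ b - b ∈ 𝔐` for all absolute integers `b`) iff `‖σ b - b‖ < 1` whenever
  `‖b‖ ≤ 1` (Neukirch II (9.3) Definition:
  `I_w = {σ ∈ G_w : w(σ x - x) > 0 for all x ∈ 𝓞}`).

The last section specialises to the completion `L = K_v = v.adicCompletion K` of a number field
at a finite place, whose valuation ring `{‖x‖ ≤ 1}` is `v.adicCompletionIntegers K`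
(`Literature.NumberTheory.GaloisRepresentations.mem_adicCompletionIntegers_iff_norm_le_one`); these are the local objects of
`Literature/NumberTheory/EllipticCurves/Sha`, `…/SelmerUnramified` (`Γ_{K_v}`, `E(K̄_v)`, `I_𝔓`).

All statements are phrased with `spectralNorm L (AlgebraicClosure L)` explicitly, so that no
normed instance on `AlgebraicClosure L` is declared (proofs use `spectralNorm.normedField`
locally, as in `EllipticCurves/ShaProofs`); for `K_v` only Mathlib's global `NormedField` instance
(`instNormedFieldValuedAdicCompletion = Valued.toNormedField`) appears in statements, the scoped
`Valued.toNontriviallyNormedField` being invoked inside proofs.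

## References

* [NeukirchANT1999] J. Neukirch, *Algebraic Number Theory*, Grundlehren 322, Springer 1999,
  Ch. II §4, Thm. (4.8) and its proof (extension of a complete valuation to algebraic extensions;
  valuation ring = integral closure; uniqueness); Ch. II §9, (9.3) Definition (decomposition and
  inertia groups `G_w ⊇ I_w`) and the remark that conjugate valuations coincide, `|σ x| = |x|`.
* S. Bosch, U. Güntzer, R. Remmert, *Non-Archimedean Analysis*, 3.2.1–3.2.4 (spectral norm), as
  formalised in Mathlib.

## Mathlib reuse

`spectralNorm`, `spectralValue_le_one_iff`, `spectralNorm_eq_of_equiv`, `spectralNorm_extends`,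
`spectralNorm.normedField`, `minpoly.isIntegrallyClosed_eq_field_fractions'`,
`Polynomial.lifts_and_natDegree_eq_and_monic`, `ValuationSubring` (integrally closed, local,
fraction field), `Ideal.LiesOver`, `Ideal.inertia`/`AddSubgroup.mem_inertia`,
`Valued.toNormedField.norm_le_one_iff`, `Valued.toNontriviallyNormedField`.
-/

noncomputable section

open Polynomial

namespace Literature.NumberTheory.GaloisRepresentations

/-! ## A complete ultrametric field `L`, its valuation ring `R`, and `Ω = L̄` -/

section General

variable {L : Type*} [NontriviallyNormedField L]

/-- **The valuation ring of `L̄` is the integral closure of the valuation ring of `L`.** For a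
nontrivially normed field `L` with valuation ring `R = {x : ‖x‖ ≤ 1}` and `x ∈ Ω = L̄`, `x` is
integral over `R` iff its spectral norm is `≤ 1`: both say that the minimal polynomial of `x`
over `L` has coefficients in `R` (`R` is integrally closed, so the minimal polynomial of an
`R`-integral element has coefficients in `R`; and `spectralValue f ≤ 1 ↔` all coefficients of
the monic `f` have norm `≤ 1`, Neukirch's (4.7)/Hensel step being replaced by the definition of
the spectral value). Neukirch, *ANT*, Ch. II (4.8), formula `(*)` in the proof.
[cite: NeukirchANT1999, Ch. II (4.8)] -/
theorem mem_absIntegers_iff_spectralNorm_le_one (R : ValuationSubring L)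
    (hR : ∀ x : L, x ∈ R ↔ ‖x‖ ≤ 1) {x : AlgebraicClosure L} :
    x ∈ absIntegers R L ↔ spectralNorm L (AlgebraicClosure L) x ≤ 1 := by
  have hxi : IsIntegral L x := Algebra.IsIntegral.isIntegral x
  rw [absIntegers, mem_integralClosure_iff, spectralNorm,
    spectralValue_le_one_iff (minpoly.monic hxi)]
  constructor
  · intro hx n
    rw [minpoly.isIntegrallyClosed_eq_field_fractions' L hx, coeff_map]
    exact (hR _).mp (SetLike.coe_mem _)
  · intro h
    have hl : minpoly L x ∈ lifts (algebraMap R L) := by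
      rw [lifts_iff_coeff_lifts]
      intro n
      exact ⟨⟨_, (hR _).mpr (h n)⟩, rfl⟩
    obtain ⟨q, hq, -, hqm⟩ := lifts_and_natDegree_eq_and_monic hl (minpoly.monic hxi)
    refine ⟨q, hqm, ?_⟩
    rw [← aeval_def, ← aeval_map_algebraMap L, hq]
    exact minpoly.aeval L x

/-- **`Γ_L` acts on `L̄` by isometries** of the spectral norm: `‖σ x‖ = ‖x‖` (the minimal
polynomial is `σ`-invariant; equivalently, uniqueness of the extended valuation, Neukirch, *ANT*,
Ch. II (4.8), and §9: conjugate valuations `w ∘ σ` of the unique `w` coincide). Mathlib's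
`spectralNorm_eq_of_equiv`, transported to `Field.absoluteGaloisGroup L`.
[cite: NeukirchANT1999, Ch. II (4.8) (uniqueness)] -/
theorem spectralNorm_absoluteGaloisGroup_smul (σ : Field.absoluteGaloisGroup L)
    (x : AlgebraicClosure L) :
    spectralNorm L (AlgebraicClosure L) (σ • x) = spectralNorm L (AlgebraicClosure L) x :=
  (spectralNorm_eq_of_equiv (Field.absoluteGaloisGroup.toAlgEquiv L σ) x).symm

/-- An element of the valuation ring `R = {‖x‖ ≤ 1}` of norm `< 1` is not a unit of `R`, i.e.
lies in the maximal ideal `{‖x‖ < 1}` of `R`. Neukirch, *ANT*, Ch. II (3.8): the valuation ring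
`𝓞 = {|x| ≤ 1}` has unit group `{|x| = 1}` and the unique maximal ideal `𝔭 = {|x| < 1}`.
[cite: NeukirchANT1999, Ch. II (3.8)] -/
theorem mem_maximalIdeal_of_norm_lt_one (R : ValuationSubring L)
    (hR : ∀ x : L, x ∈ R ↔ ‖x‖ ≤ 1) {ϖ : R} (hϖ : ‖(ϖ : L)‖ < 1) :
    ϖ ∈ IsLocalRing.maximalIdeal R := by
  rw [IsLocalRing.mem_maximalIdeal, mem_nonunits_iff]
  rintro ⟨u, rfl⟩
  have h1 : ‖(((u⁻¹ : Rˣ) : R) : L)‖ ≤ 1 := (hR _).mp (SetLike.coe_mem _)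
  have h2 : ((u : R) : L) * (((u⁻¹ : Rˣ) : R) : L) = 1 := by
    have h : ((u : R) * ((u⁻¹ : Rˣ) : R) : R) = 1 := u.mul_inv
    exact_mod_cast congrArg (fun r : R ↦ (r : L)) h
  have h3 : ‖((u : R) : L)‖ * ‖(((u⁻¹ : Rˣ) : R) : L)‖ = 1 := by
    rw [← norm_mul, h2, norm_one]
  exact (mul_lt_one_of_nonneg_of_lt_one_left (norm_nonneg _) hϖ h1).ne h3

variable [CompleteSpace L] [IsUltrametricDist L]

/-- **The prime of `L̄` above `𝓂_R` is the open unit ball.** Let `L` be complete, nontrivially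
normed and ultrametric, `R = {‖x‖ ≤ 1}` its valuation ring, and `𝔐` a prime ideal of the
absolute integers `integralClosure R L̄` lying over the maximal ideal of `R`. Then for an
absolute integer `b`: `b ∈ 𝔐 ↔ ‖b‖ < 1`. (`←`: pick `π ∈ L` with `‖π‖ > 1`; for
`‖b‖ ^ k < ‖π‖⁻¹` the element `c = b ^ k π` is an absolute integer and
`b ^ k = c · π⁻¹ ∈ 𝓂_R 𝓞 ⊆ 𝔐`, so `b ∈ 𝔐`. `→`: if `‖b‖ = 1` then `b⁻¹` is an absolute
integer, `b` is a unit and `𝔐 = ⊤`.) This is the statement that the valuation ring `{‖b‖ ≤ 1}`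
of the extended valuation is local with maximal ideal `{‖b‖ < 1}`. Neukirch, *ANT*, Ch. II
(4.8), with (3.8) (a valuation ring `{|x| ≤ 1}` is local with maximal ideal `{|x| < 1}`).
[cite: NeukirchANT1999, Ch. II (4.8) with (3.8)] -/
theorem mem_iff_spectralNorm_lt_one (R : ValuationSubring L)
    (hR : ∀ x : L, x ∈ R ↔ ‖x‖ ≤ 1) {𝔐 : Ideal (absIntegers R L)} [𝔐.IsPrime]
    [𝔐.LiesOver (IsLocalRing.maximalIdeal R)] (b : absIntegers R L) :
    b ∈ 𝔐 ↔ spectralNorm L (AlgebraicClosure L) b < 1 := by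
  letI : NormedField (AlgebraicClosure L) := spectralNorm.normedField L (AlgebraicClosure L)
  change b ∈ 𝔐 ↔ ‖(b : AlgebraicClosure L)‖ < 1
  have hint : ∀ y : AlgebraicClosure L, y ∈ absIntegers R L ↔ ‖y‖ ≤ 1 := fun y ↦
    mem_absIntegers_iff_spectralNorm_le_one R hR
  have hext : ∀ y : L, ‖algebraMap L (AlgebraicClosure L) y‖ = ‖y‖ := fun y ↦
    spectralNorm_extends y
  constructor
  · intro hb
    by_contra hlt
    have hb1 : ‖(b : AlgebraicClosure L)‖ = 1 := le_antisymm ((hint _).mp b.2) (not_lt.mp hlt)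
    have hb0 : (b : AlgebraicClosure L) ≠ 0 := by
      intro h; rw [h, norm_zero] at hb1; exact zero_ne_one hb1
    have hc : (b : AlgebraicClosure L)⁻¹ ∈ absIntegers R L := by
      rw [hint, norm_inv, hb1, inv_one]
    have hunit : IsUnit b := by
      refine IsUnit.of_mul_eq_one ⟨_, hc⟩ (Subtype.ext ?_)
      change (b : AlgebraicClosure L) * (b : AlgebraicClosure L)⁻¹ = 1
      exact mul_inv_cancel₀ hb0
    exact Ideal.IsPrime.ne_top ‹_› (Ideal.eq_top_of_isUnit_mem 𝔐 hb hunit)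
  · intro hb
    -- an element `π ∈ L` with `1 < ‖π‖`; `ϖ = π⁻¹ ∈ 𝓂_R`
    obtain ⟨π, hπ⟩ := NontriviallyNormedField.non_trivial (α := L)
    have hπ0 : π ≠ 0 := by intro h; rw [h, norm_zero] at hπ; exact not_lt.mpr zero_le_one hπ
    have hϖ1 : ‖π⁻¹‖ < 1 := by rw [norm_inv]; exact inv_lt_one_of_one_lt₀ hπ
    have hϖ0 : 0 < ‖π⁻¹‖ := norm_pos_iff.mpr (inv_ne_zero hπ0)
    set ϖ : R := ⟨π⁻¹, (hR _).mpr hϖ1.le⟩ with hϖdef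
    have hϖM : algebraMap R (absIntegers R L) ϖ ∈ 𝔐 := by
      rw [← Ideal.mem_comap, ← Ideal.under_def,
        ← Ideal.LiesOver.over (P := 𝔐) (p := IsLocalRing.maximalIdeal R)]
      exact mem_maximalIdeal_of_norm_lt_one R hR hϖ1
    -- `‖b‖ ^ k < ‖ϖ‖`, so `c = b ^ k π` is an absolute integer and `b ^ k = c ϖ ∈ 𝔐`
    obtain ⟨k, hk⟩ := exists_pow_lt_of_lt_one hϖ0 hb
    have hc : (b : AlgebraicClosure L) ^ k * algebraMap L (AlgebraicClosure L) π ∈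
        absIntegers R L := by
      rw [hint, norm_mul, norm_pow, hext]
      calc ‖(b : AlgebraicClosure L)‖ ^ k * ‖π‖ ≤ ‖π⁻¹‖ * ‖π‖ := by gcongr
        _ = 1 := by rw [norm_inv, inv_mul_cancel₀ (norm_ne_zero_iff.mpr hπ0)]
    have hbk : b ^ k = ⟨_, hc⟩ * algebraMap R (absIntegers R L) ϖ := by
      apply Subtype.ext
      change (b : AlgebraicClosure L) ^ k =
        (b : AlgebraicClosure L) ^ k * algebraMap L (AlgebraicClosure L) π *
          algebraMap R (AlgebraicClosure L) ϖ
      rw [IsScalarTower.algebraMap_apply R L (AlgebraicClosure L), mul_assoc, ← map_mul]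
      change _ = _ * algebraMap L (AlgebraicClosure L) (π * π⁻¹)
      rw [mul_inv_cancel₀ hπ0, map_one, mul_one]
    exact Ideal.IsPrime.mem_of_pow_mem ‹_› k (hbk ▸ 𝔐.mul_mem_left _ hϖM)

/-- **Uniqueness of the prime above `𝓂_R`**: two primes of `integralClosure R L̄` lying over the
maximal ideal of the valuation ring `R` of the complete field `L` coincide (both are the open
unit ball). Neukirch, *ANT*, Ch. II (4.8) (uniqueness of the extended valuation) with Ch. II §8,
(8.1)–(8.2) (extensions `w ∣ v` ↔ primes above `𝔭`). [cite: NeukirchANT1999, Ch. II (4.8)] -/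
theorem eq_of_liesOver_maximalIdeal (R : ValuationSubring L)
    (hR : ∀ x : L, x ∈ R ↔ ‖x‖ ≤ 1) (𝔐 𝔐' : Ideal (absIntegers R L)) [𝔐.IsPrime]
    [𝔐.LiesOver (IsLocalRing.maximalIdeal R)] [𝔐'.IsPrime]
    [𝔐'.LiesOver (IsLocalRing.maximalIdeal R)] : 𝔐 = 𝔐' := by
  ext b
  rw [mem_iff_spectralNorm_lt_one R hR, mem_iff_spectralNorm_lt_one R hR]

/-- **Inertia criterion.** In the situation of `mem_iff_spectralNorm_lt_one`, an element `σ` of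
`Γ_L = Gal(L̄/L)` belongs to the inertia group `I_𝔐` (Mathlib's `Ideal.inertia`:
`σ b - b ∈ 𝔐` for every absolute integer `b`) iff `‖σ b - b‖ < 1` for all `b ∈ L̄` with
`‖b‖ ≤ 1`. This is Neukirch's definition `I_w = {σ ∈ G_w : w(σ x - x) > 0 for all x ∈ 𝓞}` of the
inertia group of the (unique) extension `w` of the valuation to `L̄` (here `G_w = Γ_L`).
[cite: NeukirchANT1999, Ch. II (9.3) Definition] -/
theorem mem_inertia_iff_spectralNorm (R : ValuationSubring L)
    (hR : ∀ x : L, x ∈ R ↔ ‖x‖ ≤ 1) {𝔐 : Ideal (absIntegers R L)} [𝔐.IsPrime]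
    [𝔐.LiesOver (IsLocalRing.maximalIdeal R)] {σ : Field.absoluteGaloisGroup L} :
    σ ∈ 𝔐.inertia (Field.absoluteGaloisGroup L) ↔
      ∀ b : AlgebraicClosure L, spectralNorm L (AlgebraicClosure L) b ≤ 1 →
        spectralNorm L (AlgebraicClosure L) (σ • b - b) < 1 := by
  rw [Ideal.inertia, AddSubgroup.mem_inertia]
  constructor
  · intro h b hb
    have := h ⟨b, (mem_absIntegers_iff_spectralNorm_le_one R hR).mpr hb⟩
    rw [Submodule.mem_toAddSubgroup, mem_iff_spectralNorm_lt_one R hR] at this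
    exact this
  · intro h b
    rw [Submodule.mem_toAddSubgroup, mem_iff_spectralNorm_lt_one R hR]
    exact h b ((mem_absIntegers_iff_spectralNorm_le_one R hR).mp b.2)

end General

/-! ## The completion of a number field at a finite place -/

section NumberField

open NumberField IsDedekindDomain

variable {K : Type*} [Field K] [NumberField K] (v : HeightOneSpectrum (𝓞 K))

/-- The valuation ring `𝓞_v = v.adicCompletionIntegers K` of the completion `K_v` is the closed
unit ball of Mathlib's norm on `K_v` (`Valued.toNormedField`). Neukirch, *ANT*, Ch. II §4
(completion `K_v`, `𝓞_v = {|x|_v ≤ 1}`). [folklore] -/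
theorem mem_adicCompletionIntegers_iff_norm_le_one (x : v.adicCompletion K) :
    x ∈ v.adicCompletionIntegers K ↔ ‖x‖ ≤ 1 := by
  rw [HeightOneSpectrum.mem_adicCompletionIntegers, Valued.toNormedField.norm_le_one_iff]

/-- `mem_absIntegers_iff_spectralNorm_le_one` for `L = K_v`: the local absolute integers
`integralClosure 𝓞_v K̄_v` are the elements of `K̄_v` of spectral norm `≤ 1`.
[cite: NeukirchANT1999, Ch. II (4.8)] -/
theorem mem_absIntegers_adicCompletion_iff {x : AlgebraicClosure (v.adicCompletion K)} :
    x ∈ absIntegers (v.adicCompletionIntegers K) (v.adicCompletion K) ↔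
      spectralNorm (v.adicCompletion K) (AlgebraicClosure (v.adicCompletion K)) x ≤ 1 :=
  letI := Valued.toNontriviallyNormedField (v.adicCompletion K) (WithZero (Multiplicative ℤ))
  mem_absIntegers_iff_spectralNorm_le_one (v.adicCompletionIntegers K)
    (mem_adicCompletionIntegers_iff_norm_le_one v)

/-- `mem_iff_spectralNorm_lt_one` for `L = K_v`: a prime of the local absolute integers above
`𝓂_v` is the open unit ball of the spectral norm. [cite: NeukirchANT1999, Ch. II (4.8)] -/
theorem mem_iff_spectralNorm_lt_one_adicCompletion
    {𝔐 : Ideal (absIntegers (v.adicCompletionIntegers K) (v.adicCompletion K))} [𝔐.IsPrime]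
    [𝔐.LiesOver (IsLocalRing.maximalIdeal (v.adicCompletionIntegers K))]
    (b : absIntegers (v.adicCompletionIntegers K) (v.adicCompletion K)) :
    b ∈ 𝔐 ↔ spectralNorm (v.adicCompletion K) (AlgebraicClosure (v.adicCompletion K)) b < 1 :=
  letI := Valued.toNontriviallyNormedField (v.adicCompletion K) (WithZero (Multiplicative ℤ))
  mem_iff_spectralNorm_lt_one (v.adicCompletionIntegers K)
    (mem_adicCompletionIntegers_iff_norm_le_one v) b

/-- `eq_of_liesOver_maximalIdeal` for `L = K_v`: the local absolute integers have exactly one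
prime above `𝓂_v` (`K_v` is complete). [cite: NeukirchANT1999, Ch. II (4.8)] -/
theorem eq_of_liesOver_maximalIdeal_adicCompletion
    (𝔐 𝔐' : Ideal (absIntegers (v.adicCompletionIntegers K) (v.adicCompletion K))) [𝔐.IsPrime]
    [𝔐.LiesOver (IsLocalRing.maximalIdeal (v.adicCompletionIntegers K))] [𝔐'.IsPrime]
    [𝔐'.LiesOver (IsLocalRing.maximalIdeal (v.adicCompletionIntegers K))] : 𝔐 = 𝔐' :=
  letI := Valued.toNontriviallyNormedField (v.adicCompletion K) (WithZero (Multiplicative ℤ))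
  eq_of_liesOver_maximalIdeal (v.adicCompletionIntegers K)
    (mem_adicCompletionIntegers_iff_norm_le_one v) 𝔐 𝔐'

/-- `mem_inertia_iff_spectralNorm` for `L = K_v`: `σ ∈ Γ_{K_v}` lies in the local inertia group
`I_𝔐` iff `‖σ b - b‖ < 1` for all `b ∈ K̄_v` with `‖b‖ ≤ 1` (spectral norm).
[cite: NeukirchANT1999, Ch. II (9.3) Definition] -/
theorem mem_inertia_iff_spectralNorm_adicCompletion
    {𝔐 : Ideal (absIntegers (v.adicCompletionIntegers K) (v.adicCompletion K))} [𝔐.IsPrime]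
    [𝔐.LiesOver (IsLocalRing.maximalIdeal (v.adicCompletionIntegers K))]
    {σ : Field.absoluteGaloisGroup (v.adicCompletion K)} :
    σ ∈ 𝔐.inertia (Field.absoluteGaloisGroup (v.adicCompletion K)) ↔
      ∀ b : AlgebraicClosure (v.adicCompletion K),
        spectralNorm (v.adicCompletion K) (AlgebraicClosure (v.adicCompletion K)) b ≤ 1 →
        spectralNorm (v.adicCompletion K) (AlgebraicClosure (v.adicCompletion K)) (σ • b - b)
          < 1 :=
  letI := Valued.toNontriviallyNormedField (v.adicCompletion K) (WithZero (Multiplicative ℤ))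
  mem_inertia_iff_spectralNorm (v.adicCompletionIntegers K)
    (mem_adicCompletionIntegers_iff_norm_le_one v)

end NumberField

end Literature.NumberTheory.GaloisRepresentations
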